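import Summits.AnomalousDissipation.AnomalousDissipation.Theorems.TaylorCertificatesFloorCertificateStubFanMinimax

/-!
# Stub `stub_fanMinimax` (F) of the line `Sketch`
# (crux stmt-AnomalousDissipation-14086, `TaylorCertificates.FloorCertificateEnsembleCeiling`)

KY FAN'S CONVEX-LIKE MINIMAX PRINCIPLE (K. Fan, *Minimax theorems*, Proc. Nat. Acad. Sci. USA
39 (1953) 42–47, Theorem 2), in the `γ`-form that the line's strong-duality engine
(`…TaylorCertificatesFloorCertificateStubMinimaxAlternative`) takes as a hypothesis: `X` compact,
`Y` nonempty, `φ (·) y` lower semicontinuous, `φ` convex-like in `x` and concave-like in `y`; if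
every `x` admits a `y` with `γ < φ x y`, then ONE `y` has `γ < φ x y` for every `x`.

The registered stub F of this line is, verbatim, the registered stub S2 of the sibling line
`dissipation-deficit-duality` (crux stmt-AnomalousDissipation-14091), already proved in the tree as
`Summit.AnomalousDissipation.AnomalousDissipation.Theorems.TaylorCertificatesFloorCertificate.stub_fanMinimax`
(file `…/Theorems/TaylorCertificatesFloorCertificateStubFanMinimax.lean`: Fan's proof — finite
subcover by lower semicontinuity, separation of the convex set `{z | ∃ x, ∀ i, φ x yᵢ ≤ zᵢ}` from an
open box by `geometric_hahn_banach_open`, concave-likeness iterated along the finite family). This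
file discharges F by that theorem; no mathematics is duplicated.
-/

set_option linter.dupNamespace false

namespace Summit.AnomalousDissipation.AnomalousDissipation.Theorems.TaylorCertificatesFloorCertificateEnsembleCeiling

/-- **F `stub_fanMinimax`** — KY FAN'S CONVEX-LIKE MINIMAX PRINCIPLE (Fan 1953, Thm 2; `γ`-form):
`X` compact, `Y` nonempty, `φ (·) y` lower semicontinuous, `φ` convex-like in `x` and
concave-like in `y`; if every `x` is beaten by some `y` above `γ`, one `y` beats every `x` above
`γ`. Proof: the sibling line's landed `…Theorems.TaylorCertificatesFloorCertificate.stub_fanMinimax`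
(same statement). -/
theorem stub_fanMinimax :
    ∀ (X Y : Type) [TopologicalSpace X] [CompactSpace X] [Nonempty Y] (φ : X → Y → ℝ),
      (∀ y : Y, LowerSemicontinuous fun x : X => φ x y) →
      (∀ (x₁ x₂ : X) (t : ℝ), 0 ≤ t → t ≤ 1 → ∃ x₀ : X, ∀ y : Y, φ x₀ y ≤ t * φ x₁ y + (1 - t) * φ x₂ y) →
      (∀ (y₁ y₂ : Y) (t : ℝ), 0 ≤ t → t ≤ 1 → ∃ y₀ : Y, ∀ x : X, t * φ x y₁ + (1 - t) * φ x y₂ ≤ φ x y₀) →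
      ∀ γ : ℝ, (∀ x : X, ∃ y : Y, γ < φ x y) → ∃ y : Y, ∀ x : X, γ < φ x y :=
  Summit.AnomalousDissipation.AnomalousDissipation.Theorems.TaylorCertificatesFloorCertificate.stub_fanMinimax

end Summit.AnomalousDissipation.AnomalousDissipation.Theorems.TaylorCertificatesFloorCertificateEnsembleCeiling
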